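import Summits.ABC.ABC.Theorems.TowerExponentWindow.Negative.StubBinomialDepthWindowFloors

/-!
# `TowerExponentWindow` (stmt-ABC-1647) — negative-side lemmas V: the lever of line
`binomial-xi-d-zero-threefold` needs `C ≥ 2 − 1/n` at every odd level (Padé family)

Continuation of `StubBinomialDepthWindowFloors` (engine `depth_floor_of_families`).  The `[n−1 ∣ n−1]` Padé
approximant of `(1+t)ⁿ` is the split of the binomial expansion of `(X − 1)^(2n−1)` at `k = n`:
`Xⁿ·g_n(X) − f_n(X) = (X − 1)^(2n−1)` with `f_n(X) = Σ_{k<n} C(2n−1,k)(−X)^k`,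
`g_n(X) = Σ_{i<n} C(2n−1,n+i) Xⁱ(−1)^(n−1−i)`.  For ODD `n` and `X ≥ 1` one has `f_n(X) ≥ 1` (pair consecutive
terms; `C(2n−1,k)` increases for `k ≤ n−1`), hence `g_n(X) > 0` too, and the data
`(a₁, a₂, c₁, c₂; d) = (g_n(t+1), t+1, f_n(t+1), 1; t^(2n−1))`, `t = q^(j+1)` with `q` a prime `> f_n(1)`, are
admissible for the depth inequality with depth `(2n−1)(j+1)·log q` against heights `≤ n(j+1)·log q + O(1)`:

* `two_sub_inv_le_of_depth_odd` — **`C ≥ 2 − 1/n` at every odd level `n`** for the registered stub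
  `stub_binomialDepthWindow` (spelled out verbatim as hypothesis; no auxiliary definitions — `f_n, g_n` live
  inside the proof).

(At even levels the identity has no positive specialisation; there the floors `2` of the companion files come
from the norm forms of `ℤ[i]`, `ℤ[ω]`.)  Refuter seat cdisprove-stmt-ABC-1647 (gen 2), 2026-08-16; work file
`Cruxes/TowerExponentWindow/Disproof.lean` § (d‴).
-/

namespace Summit.ABC.ABC.Theorems.TowerExponentWindow.Negative

open Finset
open Literature.NumberTheory.DiophantineGeometry (radical_le_of_dvd_pow)

/-- Pairing of an even-length tail: `Σ_{k<2m} T(k+1) = Σ_{j<m} (T(2j+1) + T(2j+2))`. [folklore] -/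
theorem sum_range_pairs (T : ℕ → ℤ) (m : ℕ) :
    ∑ k ∈ range (2 * m), T (k + 1) = ∑ j ∈ range m, (T (2 * j + 1) + T (2 * j + 2)) := by
  induction m with
  | zero => simp
  | succ m ih =>
    rw [show 2 * (m + 1) = 2 * m + 1 + 1 by ring, Finset.sum_range_succ, Finset.sum_range_succ, ih,
      Finset.sum_range_succ]
    ring_nf

/-- **`C ≥ 2 − 1/n` at every ODD level** for the lever `stub_binomialDepthWindow` (Padé family). [folklore] -/
theorem two_sub_inv_le_of_depth_odd {n : ℕ} (hodd : Odd n) {C C' : ℝ} (hC : 0 ≤ C)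
    (h : ∀ a₁ a₂ c₁ c₂ : ℕ, 0 < a₁ → 0 < a₂ → 0 < c₁ → 0 < c₂ → Nat.Coprime (a₁ * a₂) (c₁ * c₂) →
      a₁ * a₂ ^ n ≠ c₁ * c₂ ^ n → ∀ d : ℕ, 0 < d → (d : ℤ) ∣ ((a₁ * a₂ ^ n : ℕ) : ℤ) - ((c₁ * c₂ ^ n : ℕ) : ℤ) →
      Real.log (d : ℝ) ≤ C * (Real.log ((max a₁ c₁ : ℕ) : ℝ) + Real.log ((max a₂ c₂ : ℕ) : ℝ) +
        Real.log ((UniqueFactorizationMonoid.radical d : ℕ) : ℝ)) + C') :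
    2 - 1 / (n : ℝ) ≤ C := by
  have hn : 1 ≤ n := hodd.pos
  -- the two Padé polynomials (opaque local functions)
  obtain ⟨F, hF⟩ : ∃ F : ℤ → ℤ, ∀ X, F X = ∑ k ∈ range n, (Nat.choose (2 * n - 1) k : ℤ) * (-X) ^ k :=
    ⟨_, fun _ => rfl⟩
  obtain ⟨G, hG⟩ : ∃ G : ℤ → ℤ, ∀ X, G X =
      ∑ i ∈ range n, (Nat.choose (2 * n - 1) (n + i) : ℤ) * X ^ i * (-1) ^ (n - 1 - i) :=
    ⟨_, fun _ => rfl⟩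
  -- (1) the Padé identity
  have hid0 : ∀ X : ℤ, X ^ n * G X - F X = (X - 1) ^ (2 * n - 1) := by
    intro X
    have hN : 2 * n - 1 + 1 = n + n := by omega
    rw [sub_eq_add_neg X 1, add_pow, hN, Finset.sum_range_add]
    have hlow : ∑ k ∈ range n, X ^ k * (-1) ^ (2 * n - 1 - k) * (Nat.choose (2 * n - 1) k : ℤ) = - F X := by
      rw [hF, ← Finset.sum_neg_distrib]
      refine Finset.sum_congr rfl fun k hk => ?_
      rw [Finset.mem_range] at hk
      have e : 2 * n - 1 - k = 2 * (n - 1 - k) + (k + 1) := by omega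
      rw [e, pow_add, pow_mul, neg_one_sq, one_pow, one_mul, neg_pow X k]
      ring
    have hhigh : ∑ i ∈ range n, X ^ (n + i) * (-1) ^ (2 * n - 1 - (n + i)) * (Nat.choose (2 * n - 1) (n + i) : ℤ)
        = X ^ n * G X := by
      rw [hG, Finset.mul_sum]
      refine Finset.sum_congr rfl fun i hi => ?_
      rw [Finset.mem_range] at hi
      have e : 2 * n - 1 - (n + i) = n - 1 - i := by omega
      rw [e, pow_add]
      ring
    rw [hlow, hhigh]; ring
  -- (2) `X ∣ F X − 1` and `X − 1 ∣ F X − F 1`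
  have hF1dvd : ∀ X : ℤ, X ∣ F X - 1 := by
    intro X
    rw [hF]
    obtain ⟨m, hm⟩ : ∃ m, n = m + 1 := ⟨n - 1, by omega⟩
    rw [hm, Finset.sum_range_succ']
    simp only [pow_zero, mul_one, Nat.choose_zero_right, Nat.cast_one, add_sub_cancel_right]
    refine Finset.dvd_sum fun k _ => ?_
    exact dvd_mul_of_dvd_right ((dvd_neg.mpr (dvd_refl X)).trans (dvd_pow_self (-X) (Nat.succ_ne_zero k))) _
  have hFsub : ∀ X : ℤ, X - 1 ∣ F X - F 1 := by
    intro X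
    rw [hF, hF, ← Finset.sum_sub_distrib]
    refine Finset.dvd_sum fun k _ => ?_
    have h1 : X - 1 ∣ X ^ k - 1 := by simpa using sub_dvd_pow_sub_pow X 1 k
    have e : (Nat.choose (2 * n - 1) k : ℤ) * (-X) ^ k - (Nat.choose (2 * n - 1) k : ℤ) * (-1) ^ k
        = (Nat.choose (2 * n - 1) k : ℤ) * (-1) ^ k * (X ^ k - 1) := by
      rw [neg_pow]; ring
    rw [e]; exact dvd_mul_of_dvd_right h1 _
  -- (3) positivity of `F` on `X ≥ 1` (uses `n` odd)
  have hFpos : ∀ X : ℤ, 1 ≤ X → 1 ≤ F X := by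
    intro X hX
    obtain ⟨m, hm⟩ := hodd
    rw [hF, hm, show 2 * m + 1 = (2 * m) + 1 by ring, Finset.sum_range_succ']
    simp only [pow_zero, mul_one, Nat.choose_zero_right, Nat.cast_one]
    rw [sum_range_pairs (fun k => (Nat.choose (2 * (2 * m + 1) - 1) k : ℤ) * (-X) ^ k) m]
    have hnonneg : ∀ j ∈ range m, (0:ℤ) ≤ (Nat.choose (2 * (2 * m + 1) - 1) (2 * j + 1) : ℤ) * (-X) ^ (2 * j + 1)
        + (Nat.choose (2 * (2 * m + 1) - 1) (2 * j + 2) : ℤ) * (-X) ^ (2 * j + 2) := by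
      intro j hj
      rw [Finset.mem_range] at hj
      set N := 2 * (2 * m + 1) - 1 with hNdef
      have hN : N = 4 * m + 1 := by omega
      have hchoose : (Nat.choose N (2 * j + 1) : ℤ) ≤ Nat.choose N (2 * j + 2) := by
        exact_mod_cast Nat.choose_le_succ_of_lt_half_left (by omega)
      have hXpow : (0:ℤ) ≤ X ^ (2 * j + 1) := by positivity
      have e1 : (-X) ^ (2 * j + 1) = - X ^ (2 * j + 1) := by
        rw [neg_pow, Odd.neg_one_pow ⟨j, rfl⟩]; ring
      have e2 : (-X) ^ (2 * j + 2) = X ^ (2 * j + 1) * X := by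
        rw [neg_pow, show 2 * j + 2 = 2 * (j + 1) by ring, Even.neg_one_pow ⟨j + 1, by ring⟩, one_mul,
          show 2 * (j + 1) = (2 * j + 1) + 1 by ring, pow_succ]
      rw [e1, e2]
      have h0 : (0:ℤ) ≤ (Nat.choose N (2 * j + 1) : ℤ) := by positivity
      nlinarith [mul_nonneg hXpow (sub_nonneg.mpr hchoose), mul_nonneg (mul_nonneg hXpow h0) (sub_nonneg.mpr hX)]
    have := Finset.sum_nonneg hnonneg
    linarith
  -- (4) crude size bounds `|F X|, |G X| ≤ 2^(2n−1) X^(n−1)` for `X ≥ 1`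
  have hsumchoose : (∑ k ∈ range (2 * n - 1 + 1), (Nat.choose (2 * n - 1) k : ℤ)) = 2 ^ (2 * n - 1) := by
    exact_mod_cast Nat.sum_range_choose (2 * n - 1)
  have habsF : ∀ X : ℤ, 1 ≤ X → |F X| ≤ 2 ^ (2 * n - 1) * X ^ (n - 1) := by
    intro X hX
    rw [hF]
    refine (Finset.abs_sum_le_sum_abs _ _).trans ?_
    have hterm : ∀ k ∈ range n, |(Nat.choose (2 * n - 1) k : ℤ) * (-X) ^ k| ≤
        (Nat.choose (2 * n - 1) k : ℤ) * X ^ (n - 1) := by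
      intro k hk
      rw [Finset.mem_range] at hk
      rw [abs_mul, abs_pow, abs_neg, abs_of_nonneg (by positivity : (0:ℤ) ≤ (Nat.choose (2 * n - 1) k : ℤ)),
        abs_of_nonneg (by linarith : (0:ℤ) ≤ X)]
      exact mul_le_mul_of_nonneg_left (pow_le_pow_right₀ hX (by omega)) (by positivity)
    refine (Finset.sum_le_sum hterm).trans ?_
    rw [← Finset.sum_mul]
    refine mul_le_mul_of_nonneg_right ?_ (by positivity)
    rw [← hsumchoose]
    exact Finset.sum_le_sum_of_subset_of_nonneg (Finset.range_mono (by omega)) fun _ _ _ => by positivity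
  have habsG : ∀ X : ℤ, 1 ≤ X → |G X| ≤ 2 ^ (2 * n - 1) * X ^ (n - 1) := by
    intro X hX
    rw [hG]
    refine (Finset.abs_sum_le_sum_abs _ _).trans ?_
    have hterm : ∀ i ∈ range n, |(Nat.choose (2 * n - 1) (n + i) : ℤ) * X ^ i * (-1) ^ (n - 1 - i)| ≤
        (Nat.choose (2 * n - 1) (n + i) : ℤ) * X ^ (n - 1) := by
      intro i hi
      rw [Finset.mem_range] at hi
      rw [abs_mul, abs_mul, abs_pow, abs_pow, abs_neg, abs_one, one_pow, mul_one,
        abs_of_nonneg (by positivity : (0:ℤ) ≤ (Nat.choose (2 * n - 1) (n + i) : ℤ)),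
        abs_of_nonneg (by linarith : (0:ℤ) ≤ X)]
      exact mul_le_mul_of_nonneg_left (pow_le_pow_right₀ hX (by omega)) (by positivity)
    refine (Finset.sum_le_sum hterm).trans ?_
    rw [← Finset.sum_mul]
    refine mul_le_mul_of_nonneg_right ?_ (by positivity)
    rw [← hsumchoose]
    have e : ∑ i ∈ range n, (Nat.choose (2 * n - 1) (n + i) : ℤ)
        = ∑ k ∈ Ico n (n + n), (Nat.choose (2 * n - 1) k : ℤ) := by
      rw [Finset.sum_Ico_eq_sum_range]; simp
    rw [e]
    refine Finset.sum_le_sum_of_subset_of_nonneg ?_ fun _ _ _ => by positivity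
    intro k hk
    rw [Finset.mem_Ico] at hk; rw [Finset.mem_range]; omega
  have hf1 : 1 ≤ F 1 := hFpos 1 le_rfl
  obtain ⟨q, hqge, hq⟩ := Nat.exists_infinite_primes ((F 1).toNat + 2)
  have hq2 : 2 ≤ q := hq.two_le
  have hqf : F 1 < q := by
    have : ((F 1).toNat : ℤ) = F 1 := Int.toNat_of_nonneg (by linarith)
    omega
  have hlogq : 0 < Real.log q := Real.log_pos (by exact_mod_cast (by omega : 1 < q))
  have hlog2 : 0 ≤ Real.log 2 := Real.log_nonneg (by norm_num)
  -- the parameter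
  obtain ⟨T, hT⟩ : ∃ T : ℕ → ℕ, ∀ j, T j = q ^ (j + 1) := ⟨_, fun _ => rfl⟩
  have hT1 : ∀ j, 1 ≤ T j := fun j => by rw [hT j]; exact Nat.one_le_pow _ _ (by omega)
  have hT0 : ∀ j, 0 < T j := fun j => hT1 j
  have hXZ : ∀ j, (1 : ℤ) ≤ (T j : ℤ) + 1 := fun j => by have := hT1 j; omega
  -- values
  have hFpos : ∀ j, 1 ≤ F ((T j : ℤ) + 1) := fun j => hFpos _ (hXZ j)
  have hid : ∀ j, ((T j : ℤ) + 1) ^ n * G ((T j : ℤ) + 1) - F ((T j : ℤ) + 1)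
      = (T j : ℤ) ^ (2 * n - 1) := fun j => by
    have := hid0 ((T j : ℤ) + 1); rwa [add_sub_cancel_right] at this
  have hGpos : ∀ j, 0 < G ((T j : ℤ) + 1) := fun j => by
    have h1 : 0 < ((T j : ℤ) + 1) ^ n * G ((T j : ℤ) + 1) := by
      rw [(sub_eq_iff_eq_add).mp (hid j)]; have := hFpos j; positivity
    exact pos_of_mul_pos_right h1 (by positivity)
  have hGcast : ∀ j, (((G ((T j : ℤ) + 1)).toNat : ℕ) : ℤ) = G ((T j : ℤ) + 1) := fun j =>
    Int.toNat_of_nonneg (hGpos j).le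
  have hFcast : ∀ j, (((F ((T j : ℤ) + 1)).toNat : ℕ) : ℤ) = F ((T j : ℤ) + 1) := fun j =>
    Int.toNat_of_nonneg (by have := hFpos j; linarith)
  have hlogT : ∀ j, Real.log (T j : ℝ) = ((j : ℝ) + 1) * Real.log q := fun j => by
    rw [hT j]; push_cast; rw [Real.log_pow]; push_cast; ring
  have hnR : (1 : ℝ) ≤ n := by exact_mod_cast hn
  have hnpos : (0 : ℝ) < n := by linarith
  have hcastp : ((2 * n - 1 : ℕ) : ℝ) = 2 * n - 1 := by
    rw [Nat.cast_sub (by omega), Nat.cast_mul]; norm_num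
  have key := depth_floor_of_families hC h (p := 2 * n - 1) (q := n) (r := 3 * n * Real.log 2 + Real.log q)
    (fun j => ((j : ℝ) + 1) * Real.log q) (fun K => ?_) (fun j => ?_)
  · -- conclusion: (2n - 1) ≤ C n
    have e : (2:ℝ) - 1 / n = (2 * n - 1) / n := by field_simp
    rw [e, div_le_iff₀ hnpos]
    linarith [key]
  · obtain ⟨j, hj⟩ := exists_nat_ge (K / Real.log q)
    refine ⟨j, ?_⟩
    have := (div_le_iff₀ hlogq).mp hj
    nlinarith
  refine ⟨(G ((T j : ℤ) + 1)).toNat, T j + 1, (F ((T j : ℤ) + 1)).toNat, 1, (T j) ^ (2 * n - 1),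
    by have := hGpos j; omega, by omega, by have := hFpos j; omega, one_pos, pow_pos (hT0 j) _,
    ?_, ?_, ?_, ?_, ?_⟩
  · -- coprimality
    rw [mul_one]
    refine Nat.Coprime.mul_left ?_ ?_
    · refine Nat.coprime_of_dvd fun p hp hpa hpb => ?_
      have hpa' : (p : ℤ) ∣ G ((T j : ℤ) + 1) := by rw [← hGcast j]; exact_mod_cast hpa
      have hpb' : (p : ℤ) ∣ F ((T j : ℤ) + 1) := by rw [← hFcast j]; exact_mod_cast hpb
      have hpt : (p : ℤ) ∣ (T j : ℤ) ^ (2 * n - 1) := by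
        rw [← hid j]; exact dvd_sub (dvd_mul_of_dvd_right hpa' _) hpb'
      have hpt' : p ∣ T j := hp.dvd_of_dvd_pow (by exact_mod_cast hpt : p ∣ T j ^ (2 * n - 1))
      have hpq'' : p ∣ q ^ (j + 1) := hT j ▸ hpt'
      have hpq : p = q := (Nat.prime_dvd_prime_iff_eq hp hq).mp (hp.dvd_of_dvd_pow hpq'')
      subst hpq
      have h1 : (p : ℤ) ∣ F ((T j : ℤ) + 1) - F 1 :=
        (dvd_trans (by rw [add_sub_cancel_right]; exact_mod_cast hpt') (hFsub _))
      have h2 : (p : ℤ) ∣ F 1 := by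
        have := dvd_sub hpb' h1; rwa [sub_sub_cancel] at this
      have h3 := Int.le_of_dvd (by linarith) h2
      linarith
    · refine Nat.coprime_of_dvd fun p hp hpa hpb => ?_
      have hpa' : (p : ℤ) ∣ (T j : ℤ) + 1 := by exact_mod_cast hpa
      have hpb' : (p : ℤ) ∣ F ((T j : ℤ) + 1) := by rw [← hFcast j]; exact_mod_cast hpb
      have h1 : (p : ℤ) ∣ F ((T j : ℤ) + 1) - 1 := hpa'.trans (hF1dvd _)
      have h2 : (p : ℤ) ∣ 1 := by have := dvd_sub hpb' h1; rwa [sub_sub_cancel] at this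
      have h3 : p ∣ 1 := by exact_mod_cast h2
      exact hp.one_lt.ne' (Nat.dvd_one.mp h3)
  · -- a₁ a₂ⁿ ≠ c₁
    intro he
    have he' : (((G ((T j : ℤ) + 1)).toNat : ℕ) : ℤ) * ((T j : ℤ) + 1) ^ n
        = (((F ((T j : ℤ) + 1)).toNat : ℕ) : ℤ) * 1 ^ n := by exact_mod_cast he
    rw [hGcast, hFcast, one_pow, mul_one, mul_comm] at he'
    have := hid j
    rw [he', sub_self] at this
    have hpos : (0 : ℤ) < (T j : ℤ) ^ (2 * n - 1) := pow_pos (by exact_mod_cast hT0 j) _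
    rw [← this] at hpos; exact lt_irrefl _ hpos
  · -- divisibility
    have e : ((((G ((T j : ℤ) + 1)).toNat * (T j + 1) ^ n : ℕ)) : ℤ)
        - ((((F ((T j : ℤ) + 1)).toNat * 1 ^ n : ℕ)) : ℤ) = (T j : ℤ) ^ (2 * n - 1) := by
      have e1 : (((T j + 1) ^ n : ℕ) : ℤ) = ((T j : ℤ) + 1) ^ n := by push_cast; ring
      have e2 : ((1 ^ n : ℕ) : ℤ) = 1 := by simp
      rw [Nat.cast_mul, Nat.cast_mul, hGcast, hFcast, e1, e2, mul_one, mul_comm]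
      exact hid j
    rw [e, Nat.cast_pow]
  · -- depth
    have e : Real.log (((T j) ^ (2 * n - 1) : ℕ) : ℝ) = (2 * n - 1) * (((j:ℝ) + 1) * Real.log q) := by
      push_cast; rw [Real.log_pow, hcastp, hlogT]
    exact le_of_eq e.symm
  · -- heights
    have hTj1 : (1 : ℝ) ≤ (T j : ℝ) := by exact_mod_cast hT1 j
    have hXR : (1 : ℝ) ≤ (T j : ℝ) + 1 := by linarith
    -- log max(a₁,c₁) ≤ (2n-1) log 2 + (n-1) log X
    have hbd : ∀ z : ℤ, |z| ≤ 2 ^ (2 * n - 1) * ((T j : ℤ) + 1) ^ (n - 1) → 0 < z →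
        Real.log ((z.toNat : ℕ) : ℝ) ≤ (2 * n - 1) * Real.log 2 + (n - 1) * Real.log ((T j : ℝ) + 1) := by
      intro z hz hz0
      have hzc : ((z.toNat : ℕ) : ℝ) = (z : ℝ) := by
        have : ((z.toNat : ℕ) : ℤ) = z := Int.toNat_of_nonneg hz0.le
        exact_mod_cast this
      rw [abs_of_pos hz0] at hz
      have hzR : (z : ℝ) ≤ (2 : ℝ) ^ (2 * n - 1) * ((T j : ℝ) + 1) ^ (n - 1) := by exact_mod_cast hz
      rw [hzc]
      calc Real.log (z : ℝ) ≤ Real.log ((2 : ℝ) ^ (2 * n - 1) * ((T j : ℝ) + 1) ^ (n - 1)) :=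
            Real.log_le_log (by exact_mod_cast hz0) hzR
        _ = (2 * n - 1) * Real.log 2 + (n - 1) * Real.log ((T j : ℝ) + 1) := by
            rw [Real.log_mul (by positivity) (by positivity), Real.log_pow, Real.log_pow, hcastp,
              Nat.cast_sub hn]; push_cast; ring
    have hA := hbd _ (habsG _ (hXZ j)) (hGpos j)
    have hB := hbd _ (habsF _ (hXZ j)) (by have := hFpos j; linarith)
    have hmax1 : Real.log ((max (G ((T j : ℤ) + 1)).toNat (F ((T j : ℤ) + 1)).toNat : ℕ) : ℝ)
        ≤ (2 * n - 1) * Real.log 2 + (n - 1) * Real.log ((T j : ℝ) + 1) := by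
      rcases le_total (G ((T j : ℤ) + 1)).toNat (F ((T j : ℤ) + 1)).toNat with hle | hle
      · rw [max_eq_right hle]; exact hB
      · rw [max_eq_left hle]; exact hA
    have hX2 : Real.log ((T j : ℝ) + 1) ≤ Real.log 2 + Real.log (T j : ℝ) := by
      rw [← Real.log_mul (by norm_num) (by positivity)]
      exact Real.log_le_log (by positivity) (by linarith)
    have hmax2 : Real.log ((max (T j + 1) 1 : ℕ) : ℝ) ≤ Real.log 2 + Real.log (T j : ℝ) := by
      rw [max_eq_left (by omega : 1 ≤ T j + 1)]; push_cast; exact hX2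
    have hrad : UniqueFactorizationMonoid.radical (T j ^ (2 * n - 1)) ≤ q := by
      refine radical_le_of_dvd_pow (n := (j + 1) * (2 * n - 1)) (by omega) ?_
      rw [hT j, ← pow_mul]
    have hlog3 : Real.log ((UniqueFactorizationMonoid.radical (T j ^ (2 * n - 1)) : ℕ) : ℝ) ≤ Real.log q :=
      Real.log_le_log (by exact_mod_cast Nat.radical_pos _) (by exact_mod_cast hrad)
    have hX0 : 0 ≤ Real.log ((T j : ℝ) + 1) := Real.log_nonneg hXR
    rw [hlogT] at hmax2 hX2
    have hn1 : (0:ℝ) ≤ (n:ℝ) - 1 := by linarith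
    nlinarith [mul_le_mul_of_nonneg_left hX2 hn1, mul_nonneg hn1 hlog2]

end Summit.ABC.ABC.Theorems.TowerExponentWindow.Negative
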